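import Literature.AnabelianGeometry.SemiGraphs.BTempQDPairCategoryPNonVacuity
import Literature.AnabelianGeometry.SemiGraphs.BTempQDPairQuotientFunctor
import Literature.AnabelianGeometry.SemiGraphs.QuasiTemperoidsNondegenerateObj
import Literature.AnabelianGeometry.SemiGraphs.QuasiTemperoidsQDPairsComponents
import Literature.AnabelianGeometry.SemiGraphs.QuasiTemperoidsQDPairsWeaklyConnected
import Literature.AnabelianGeometry.SemiGraphs.TemperedAnabelianTowerWitness
import HarnessLib

/-!
# [SemiAnbd] Appendix (quasi-temperoids): NON-VACUITY of the predicates `IsNondegenerateObj`,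
# `IsComponent`, `QDPair.IsQuotient`, `QDPair.IsWeaklyConnected` at the carrier `B^temp(Π)`

Mochizuki, *Semi-graphs of anabelioids*, Publ. RIMS **42** (2006) 221–322, Appendix «Quasi-temperoids»,
author's manuscript pp. 79–82: Def. A.1 (ii) (nondegenerate objects) [cite: MochizukiSemiAnbd2006, Def A.1(ii) p.79],
"`π₀(A)`, the set of connected components" (p. 79), Def. A.3 (i) (weakly / strongly connected QD-pairs)
and Def. A.3 (iii) (quotients of QD-pairs) [cite: MochizukiSemiAnbd2006, Def A.3 p.82].

abc-iut cell, D-0079 L-F sub-cell [SemiAnbd]+[CombGC], pack E (§0/§2/Appendix), row «LF-E-QT-NV» of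
abc-iut-L3-lead β3 (3) (this seat = abc-iut-L3-d3).  PROOF-ONLY file (no definition, no new named fact):
for the four PRED-NV rows F-1614 `IsNondegenerateObj`, F-1625 `IsComponent`, F-1628 `QDPair.IsQuotient`,
F-1630 `QDPair.IsWeaklyConnected` (predicates whose universal closures are refuted / never claimed in
print) it records NAMED non-vacuity instances at the carrier `B^temp(Π)` = `BTemp Π` of a TEMPERED group
`Π` (and its trivial-topology specialisation), knit BY NAME from theorems already in the tree:

* `isNondegenerateObj_nonVacuity_cosetObj` — the coset object `Π/K` (`K` open) is nondegenerate
  (`QDPair.isConnectedObj_cosetObj` + `IsConnectedQuasiTemperoid.isNondegenerateObj_of_isConnectedObj`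
  with `QDPair.isConnectedQuasiTemperoid_bTemp`); `isNondegenerateObj_nonVacuity_punitObj` — so is the one-point
  object;
* `isComponent_nonVacuity_cosetObj` / `…_punitObj` — the identity of `Π/K` (resp. of the point) is a
  connected component (`IsConnectedQuasiTemperoid.isComponent_id`);
* `isQuotient_nonVacuity` — EVERY QD-pair `(X, Γ)` of `B^temp(Π)` has the quotient `X → X/Γ`
  (abc-iut-w5-d220's `QDPair.isQuotient_orbitQuotientπ`), in particular `isQuotient_nonVacuity_cosetObj`;
* `isWeaklyConnected_nonVacuity_cosetObj` / `…_punitObj` — the strongly connected pairs `(Π/K, {1})`,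
  `(pt, {1})` are weakly connected (`QDPair.IsStronglyConnected.isWeaklyConnected`);
* `quasiTemperoidPredicates_nonVacuity` — the four existence statements bundled, for every tempered `Π`;
  `quasiTemperoidPredicates_nonVacuity_of_discreteTopology` — hence for every countable discrete group
  (`isTempered_of_discreteTopology`), a hypothesis-free inhabitant of the hypothesis `IsTempered`.

CAVEAT (recorded, not decided here — L3-lead β3 (3)): the L-F «genuine carrier» of the Appendix is
`B^temp` of the tempered fundamental group of a hyperbolic curve / of a semi-graph of anabelioids; the
instances below are stated for an ARBITRARY tempered `Π` (so they specialise to any such carrier the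
tree certifies as tempered, e.g. the [EtTh] setting models `isTempered_PiTpκ`, `isTempered_gfp`), and the
closing discrete specialisation is only the cheapest kernel inhabitant.  Nothing here takes a side on
[IUTchIII] Cor. 3.12; typed ≠ proved for anything but these instances.
-/

open CategoryTheory

namespace Literature.AnabelianGeometry.SemiGraphs

open Literature.AlgebraicGeometry.Frobenioids (IsConnectedObj)
open Literature.AlgebraicGeometry.Frobenioids.QuasiTemperoid (IsConnectedQuasiTemperoid cosetObj)

universe u

variable {G : Type u} [Group G] [TopologicalSpace G] [IsTopologicalGroup G]

/-! ### F-1614 `IsNondegenerateObj` -/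

/-- **Non-vacuity of `IsNondegenerateObj` (Def. A.1 (ii)) at `B^temp(Π)`**: for `Π` tempered and
`K ≤ Π` open, the coset object `Π/K` is nondegenerate (it is connected, and `B^temp(Π)` is a connected
quasi-temperoid, in which connected objects are nondegenerate). [cite: MochizukiSemiAnbd2006, Def A.1(ii) p.79] -/
theorem isNondegenerateObj_nonVacuity_cosetObj (hG : IsTempered G) (K : Subgroup G)
    (hK : IsOpen (K : Set G)) : IsNondegenerateObj (cosetObj G hG K hK) :=
  (QDPair.isConnectedQuasiTemperoid_bTemp hG).isNondegenerateObj_of_isConnectedObj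
    (QDPair.isConnectedObj_cosetObj hG K hK)

/-- **Non-vacuity of `IsNondegenerateObj` at the one-point object** of `B^temp(Π)`, `Π` tempered.
[cite: MochizukiSemiAnbd2006, Def A.1(ii) p.79] -/
theorem isNondegenerateObj_nonVacuity_punitObj (hG : IsTempered G) :
    IsNondegenerateObj (BTemp.punitObj : BTemp G) :=
  (QDPair.isConnectedQuasiTemperoid_bTemp hG).isNondegenerateObj_of_isConnectedObj QDPair.isConnectedObj_punitObj

/-! ### F-1625 `IsComponent` -/

/-- **Non-vacuity of `IsComponent` ("connected component", Appendix p. 79) at `B^temp(Π)`**: for `Π`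
tempered and `K ≤ Π` open, the identity of the coset object `Π/K` is a connected component of `Π/K`.
[cite: MochizukiSemiAnbd2006, Def A.3(i) p.82] -/
theorem isComponent_nonVacuity_cosetObj (hG : IsTempered G) (K : Subgroup G)
    (hK : IsOpen (K : Set G)) : IsComponent (𝟙 (cosetObj G hG K hK)) :=
  (QDPair.isConnectedQuasiTemperoid_bTemp hG).isComponent_id (QDPair.isConnectedObj_cosetObj hG K hK)

/-- **Non-vacuity of `IsComponent` at the one-point object** of `B^temp(Π)`, `Π` tempered.
[cite: MochizukiSemiAnbd2006, Def A.3(i) p.82] -/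
theorem isComponent_nonVacuity_punitObj (hG : IsTempered G) :
    IsComponent (𝟙 (BTemp.punitObj : BTemp G)) :=
  (QDPair.isConnectedQuasiTemperoid_bTemp hG).isComponent_id QDPair.isConnectedObj_punitObj

/-! ### F-1628 `QDPair.IsQuotient` -/

/-- **Non-vacuity of `QDPair.IsQuotient` (Def. A.3 (iii)) at `B^temp(Π)`**: every QD-pair `(X, Γ)` of
`B^temp(Π)` has a quotient, namely the orbit `Π`-set `X/Γ` with its projection (abc-iut-w5-d220's
`QDPair.isQuotient_orbitQuotientπ`, re-exported under the L-F naming scheme).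
[cite: MochizukiSemiAnbd2006, Def A.3(iii) p.82] -/
theorem isQuotient_nonVacuity (P : QDPair (BTemp G)) : P.IsQuotient P.orbitQuotientπ :=
  P.isQuotient_orbitQuotientπ

/-- **Non-vacuity of `QDPair.IsQuotient` at the coset pair `(Π/K, {1})`**, `Π` tempered, `K` open.
[cite: MochizukiSemiAnbd2006, Def A.3(iii) p.82] -/
theorem isQuotient_nonVacuity_cosetObj (hG : IsTempered G) (K : Subgroup G) (hK : IsOpen (K : Set G)) :
    (QDPair.trivialPair (cosetObj G hG K hK)).IsQuotient
      (QDPair.trivialPair (cosetObj G hG K hK)).orbitQuotientπ :=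
  isQuotient_nonVacuity _

/-! ### F-1630 `QDPair.IsWeaklyConnected` -/

/-- **Non-vacuity of `QDPair.IsWeaklyConnected` (Def. A.3 (i)) at `B^temp(Π)`**: for `Π` tempered and
`K ≤ Π` open, the QD-pair `(Π/K, {1})` is weakly connected (it is strongly connected).
[cite: MochizukiSemiAnbd2006, Def A.3(i) p.82] -/
theorem isWeaklyConnected_nonVacuity_cosetObj (hG : IsTempered G) (K : Subgroup G)
    (hK : IsOpen (K : Set G)) : (QDPair.trivialPair (cosetObj G hG K hK)).IsWeaklyConnected :=
  QDPair.IsStronglyConnected.isWeaklyConnected (QDPair.isConnectedObj_cosetObj hG K hK)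

omit [IsTopologicalGroup G] in
/-- **Non-vacuity of `QDPair.IsWeaklyConnected` at the one-point pair `(pt, {1})`** (any topological
group `Π`). [cite: MochizukiSemiAnbd2006, Def A.3(i) p.82] -/
theorem isWeaklyConnected_nonVacuity_punitObj :
    (QDPair.trivialPair (BTemp.punitObj : BTemp G)).IsWeaklyConnected :=
  QDPair.IsStronglyConnected.isWeaklyConnected QDPair.isStronglyConnected_trivialPair_punitObj

/-! ### The four existence statements, bundled -/

/-- **The four Appendix predicates are inhabited at `B^temp(Π)` for every tempered `Π`**: some object
is nondegenerate, some arrow is a connected component, some QD-pair has a quotient, some QD-pair is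
weakly connected. [cite: MochizukiSemiAnbd2006, Def A.3 p.82] -/
theorem quasiTemperoidPredicates_nonVacuity (hG : IsTempered G) :
    (∃ A : BTemp G, IsNondegenerateObj A) ∧
      (∃ (C A : BTemp G) (ι : C ⟶ A), IsComponent ι) ∧
      (∃ (P : QDPair (BTemp G)) (B : BTemp G) (φ : P.A ⟶ B), P.IsQuotient φ) ∧
      ∃ P : QDPair (BTemp G), P.IsWeaklyConnected :=
  ⟨⟨_, isNondegenerateObj_nonVacuity_punitObj hG⟩, ⟨_, _, _, isComponent_nonVacuity_punitObj hG⟩,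
    ⟨_, _, _, isQuotient_nonVacuity (QDPair.trivialPair (BTemp.punitObj : BTemp G))⟩,
    ⟨_, isWeaklyConnected_nonVacuity_punitObj⟩⟩

/-- **Hypothesis-free inhabitant**: a countable discrete group is tempered
(`isTempered_of_discreteTopology`), so the four predicates are inhabited at `B^temp(F)` for every
countable discrete `F` (e.g. `F = ℤ`, a free group of finite rank). [cite: MochizukiSemiAnbd2006, Def 3.1(i) p.33] -/
theorem quasiTemperoidPredicates_nonVacuity_of_discreteTopology {F : Type u} [Group F]
    [TopologicalSpace F] [DiscreteTopology F] [Countable F] :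
    (∃ A : BTemp F, IsNondegenerateObj A) ∧
      (∃ (C A : BTemp F) (ι : C ⟶ A), IsComponent ι) ∧
      (∃ (P : QDPair (BTemp F)) (B : BTemp F) (φ : P.A ⟶ B), P.IsQuotient φ) ∧
      ∃ P : QDPair (BTemp F), P.IsWeaklyConnected :=
  haveI : IsTopologicalGroup F := inferInstance
  quasiTemperoidPredicates_nonVacuity isTempered_of_discreteTopology

end Literature.AnabelianGeometry.SemiGraphs
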